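import Summits.NavierStokesRegularity.NavierStokesRegularity.Theorems.PerpetualPumpThesisBilinearOperatorWeighted
import Literature.Analysis.FluidPDE.TaoAveragedComplexAverageReal

/-!
# Stub B (`bilinearOperator`) for `PerpetualPump.Thesis`, part III: the averaged form on
# `H¹⁰ × H¹⁰ × H⁻⁹`

Support file (part 3 of the stub `bilinearOperator` of line `SketchIdeator2`, crux
stmt-NavierStokesRegularity-1832). For an *arbitrary* averaging datum `𝒜` (T. Tao, J. Amer.
Math. Soc. 29 (2016), arXiv:1402.0290v3, (1.12)–(1.13); no symmetry, no cancellation) the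
duality form `⟨B̃(u,v), w⟩ = 𝒜.form u v w = ∫_Ω ⟨B(A₁u, A₂v), A₃w⟩ dμ` obeys

* **the tame bound** (registered sub-goal `stub_bilinearOperator_F`)
  `|⟨B̃(u,v), w⟩| ≤ K(𝒜) ‖u‖_{H¹⁰} ‖v‖_{H¹⁰} ‖w‖_{H⁻⁹}` for `u, v` of finite `H¹⁰` norm and every
  `w ∈ L²` (Tao, (1.14): "`B̃` obeys the same Sobolev bounds as `B`", one derivative lost). This
  is part I (`enorm_eulerForm_le_weighted`, the `H¹⁰ × H¹⁰ × H⁻⁹` bound for `B`) pushed through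
  the slots `Aᵢ = mᵢ(D) Rot_{Rᵢ} Dil_{λᵢ}`: slots 1, 2 by the tree's `eFourierSobolevNorm_slot_le`
  (`s = 10`), slot 3 by the **negative-order** slot bound
  `‖A w‖_{H⁻⁹} ≤ ‖m‖₀ max(1, λ⁻¹)⁹ ‖w‖_{H⁻⁹}` (`eFourierSobolevNorm_slot_le_of_nonpos`, new: for
  `s ≤ 0` the dilation costs `max(1,λ⁻¹)^{-s}` instead of `max(1,λ)^s`), then the moment bound
  `𝔼 ‖m₁‖₀‖m₂‖₀‖m₃‖₀ < ∞`;
* **realness** on real fields (`form_im_eq_zero`: each `Aᵢ x` is Fourier-Hermitian for real `x`,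
  and the Euler form is real on Hermitian fields, tree `eulerForm_im_of_isFourierHermitian`);
* **trilinearity**: additivity and homogeneity in the first two slots on fields of finite `H¹⁰`
  norm (`form_add₁`, `form_smul₁`, `form_add₂`, `form_smul₂`; additivity needs the absolute
  convergence of (1.3) and of (1.13), tree `eulerForm_add_smul₁/₂`, `integrable_eulerForm_slot`)
  and `ℂ`-linearity in the third slot (`form_add₃`, `form_smul₃`, tree
  `average_eulerForm_add_smul`).

## References

* T. Tao, J. Amer. Math. Soc. 29 (2016), 601–674, arXiv:1402.0290v3, §1.1 (1.10)–(1.14), p. 7.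
-/

noncomputable section

open MeasureTheory Set Filter Topology FourierTransform
open scoped ENNReal NNReal ComplexConjugate

set_option linter.dupNamespace false

namespace Summit.NavierStokesRegularity.NavierStokesRegularity.Theorems.PerpetualPumpThesis.B

open Literature.Analysis.FluidPDE Literature.Analysis.FluidPDE.Tao2016
open Literature.Analysis.FunctionSpaces (eFourierSobolevNorm)

/-! ### Dilations and slots on negative-order Sobolev spaces -/

/-- The weight comparison for negative orders: for `s ≤ 0` and `a > 0`,
`(1 + |η/a|²)^s ≤ max(1, a)^{-2s} (1 + |η|²)^s` (since `1 + |η|² ≤ max(1,a)² (1 + |η/a|²)` and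
`x ↦ x^s` is antitone). -/
theorem sobolevWeight_dilate_le_of_nonpos {s : ℝ} (hs : s ≤ 0) {a : ℝ} (ha : 0 < a)
    (η : EuclideanSpace ℝ (Fin 3)) :
    (1 + ‖a⁻¹ • η‖ ^ 2) ^ s ≤ (max 1 a ^ 2) ^ (-s) * (1 + ‖η‖ ^ 2) ^ s := by
  set M : ℝ := max 1 a ^ 2 with hM
  have hM1 : 1 ≤ M := one_le_pow₀ (le_max_left 1 a)
  have hMpos : 0 < M := lt_of_lt_of_le one_pos hM1
  have hX : 0 < 1 + ‖a⁻¹ • η‖ ^ 2 := by positivity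
  -- `1 + |η|² ≤ M (1 + |η/a|²)`
  have hcmp : (1 + ‖η‖ ^ 2) / M ≤ 1 + ‖a⁻¹ • η‖ ^ 2 := by
    rw [div_le_iff₀ hMpos, norm_smul, mul_pow, Real.norm_of_nonneg (inv_pos.2 ha).le]
    have h2 : 1 ≤ max 1 a ^ 2 * a⁻¹ ^ 2 := by
      rw [← mul_pow]
      refine one_le_pow₀ ?_
      rw [le_mul_inv_iff₀ ha, one_mul]
      exact le_max_right _ _
    nlinarith [sq_nonneg ‖η‖, mul_le_mul_of_nonneg_right h2 (sq_nonneg ‖η‖)]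
  calc (1 + ‖a⁻¹ • η‖ ^ 2) ^ s ≤ ((1 + ‖η‖ ^ 2) / M) ^ s :=
        Real.rpow_le_rpow_of_nonpos (by positivity) hcmp hs
    _ = (max 1 a ^ 2) ^ (-s) * (1 + ‖η‖ ^ 2) ^ s := by
        rw [Real.div_rpow (by positivity) hMpos.le, Real.rpow_neg hMpos.le, hM]
        ring

/-- `∫ (1+|ξ|²)^s |a^{3/2} ĝ(aξ)|² dξ ≤ max(1,a)^{-2s} ∫ (1+|η|²)^s |ĝ(η)|² dη` for `a > 0` and
`s ≤ 0`. -/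
theorem sobolevWeightIntegral_dilate_le_of_nonpos {s : ℝ} (hs : s ≤ 0) {a : ℝ} (ha : 0 < a)
    (g : EuclideanSpace ℝ (Fin 3) → EuclideanSpace ℂ (Fin 3)) :
    sobolevWeightIntegral s (fun ξ => (((a ^ (3 / 2 : ℝ) : ℝ)) : ℂ) • g (a • ξ)) ≤
      ENNReal.ofReal ((max 1 a ^ 2) ^ (-s)) * sobolevWeightIntegral s g := by
  rw [sobolevWeightIntegral_dilate s ha g, sobolevWeightIntegral,
    ← lintegral_const_mul' _ _ ENNReal.ofReal_ne_top]
  refine lintegral_mono fun η => ?_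
  rw [← mul_assoc, ← ENNReal.ofReal_mul (by positivity)]
  gcongr
  exact sobolevWeight_dilate_le_of_nonpos hs ha η

/-- **`Dil_λ` on negative-order Sobolev spaces**: `‖Dil_λ u‖²_{H^s} ≤ max(1,λ⁻¹)^{-2s} ‖u‖²_{H^s}`
for `λ > 0`, `s ≤ 0` (Tao 2016, p. 6: dilations with `λ` in a compact subset of `(0,∞)` "and
their inverses" are uniformly bounded on Sobolev spaces). -/
theorem sobolevWeightIntegral_fourierFn_dil_le_of_nonpos {s : ℝ} (hs : s ≤ 0) {c : ℝ} (hc : 0 < c)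
    (u : L2C) :
    sobolevWeightIntegral s (fourierFn (dil c u)) ≤
      ENNReal.ofReal ((max 1 c⁻¹ ^ 2) ^ (-s)) * sobolevWeightIntegral s (fourierFn u) := by
  rw [sobolevWeightIntegral_congr_ae (fourierFn_dil u hc)]
  exact sobolevWeightIntegral_dilate_le_of_nonpos hs (inv_pos.2 hc) (fourierFn u)

/-- **Slots are bounded on `H^s`, `s ≤ 0`**: for `A = m(D) Rot_R Dil_λ` a slot of a complex average,
`‖A u‖²_{H^s} ≤ ‖m‖₀² max(1,λ⁻¹)^{-2s} ‖u‖²_{H^s}`. -/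
theorem sobolevWeightIntegral_slot_le_of_nonpos (𝒟 : ComplexAveragingDatum) (i : Fin 3) (θ : 𝒟.Ω)
    {s : ℝ} (hs : s ≤ 0) (u : L2C) :
    sobolevWeightIntegral s (fourierFn (𝒟.slot i θ u)) ≤
      symbolSeminorm 0 (𝒟.m i θ) ^ 2 * ENNReal.ofReal ((max 1 (𝒟.lam i θ)⁻¹ ^ 2) ^ (-s)) *
        sobolevWeightIntegral s (fourierFn u) := by
  unfold ComplexAveragingDatum.slot
  calc sobolevWeightIntegral s (fourierFn (fourierMultiplier (𝒟.symbolLp i θ)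
        (rot (𝒟.R i θ) (dil (𝒟.lam i θ) u))))
      ≤ symbolSeminorm 0 (𝒟.m i θ) ^ 2 *
          sobolevWeightIntegral s (fourierFn (rot (𝒟.R i θ) (dil (𝒟.lam i θ) u))) :=
        sobolevWeightIntegral_fourierMultiplier_le s _ (𝒟.ae_enorm_symbolLp_le i θ)
    _ = symbolSeminorm 0 (𝒟.m i θ) ^ 2 * sobolevWeightIntegral s (fourierFn (dil (𝒟.lam i θ) u)) := by
        rw [sobolevWeightIntegral_fourierFn_rot]
    _ ≤ symbolSeminorm 0 (𝒟.m i θ) ^ 2 * (ENNReal.ofReal ((max 1 (𝒟.lam i θ)⁻¹ ^ 2) ^ (-s)) *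
          sobolevWeightIntegral s (fourierFn u)) :=
        mul_le_mul' le_rfl (sobolevWeightIntegral_fourierFn_dil_le_of_nonpos hs (𝒟.lam_pos i θ) u)
    _ = _ := by ring

/-- The same bound for the norms: `‖A u‖_{H^s} ≤ ‖m‖₀ max(1,λ⁻¹)^{-s} ‖u‖_{H^s}` (`s ≤ 0`). -/
theorem eFourierSobolevNorm_slot_le_of_nonpos (𝒟 : ComplexAveragingDatum) (i : Fin 3) (θ : 𝒟.Ω)
    {s : ℝ} (hs : s ≤ 0) (u : L2C) :
    eFourierSobolevNorm s (𝒟.slot i θ u) ≤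
      symbolSeminorm 0 (𝒟.m i θ) * ENNReal.ofReal (max 1 (𝒟.lam i θ)⁻¹ ^ (-s)) *
        eFourierSobolevNorm s u := by
  have hm : (0 : ℝ) ≤ max 1 (𝒟.lam i θ)⁻¹ := le_trans zero_le_one (le_max_left _ _)
  rw [eFourierSobolevNorm_eq, eFourierSobolevNorm_eq]
  calc sobolevWeightIntegral s (fourierFn (𝒟.slot i θ u)) ^ (1 / 2 : ℝ)
      ≤ (symbolSeminorm 0 (𝒟.m i θ) ^ 2 * ENNReal.ofReal ((max 1 (𝒟.lam i θ)⁻¹ ^ 2) ^ (-s)) *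
          sobolevWeightIntegral s (fourierFn u)) ^ (1 / 2 : ℝ) :=
        ENNReal.rpow_le_rpow (sobolevWeightIntegral_slot_le_of_nonpos 𝒟 i θ hs u) (by norm_num)
    _ = _ := by
        rw [ENNReal.mul_rpow_of_nonneg _ _ (by norm_num), ENNReal.mul_rpow_of_nonneg _ _ (by norm_num)]
        congr 2
        · rw [← ENNReal.rpow_natCast, ← ENNReal.rpow_mul]
          norm_num
        · rw [ENNReal.ofReal_rpow_of_nonneg (by positivity) (by norm_num), ← Real.rpow_natCast,
            ← Real.rpow_mul hm, ← Real.rpow_mul hm]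
          simp only [Nat.cast_ofNat]
          rw [show (2 : ℝ) * -s * (1 / 2) = -s by ring]

/-! ### The tame bound for the averaged form -/

/-- **Pointwise bound for the integrand of (1.13) on `H¹⁰ × H¹⁰ × H⁻⁹`**: if
`C⁻¹ ≤ λ_{i,θ} ≤ C` then, with `M = max(1, C)` and `C_emb = (∫ (1+|ξ|²)^{-10})^{1/2}`,
`|⟨B(A₁u, A₂v), A₃w⟩| ≤ π 2¹⁰ C_emb M¹⁰ M¹⁰ M⁹ ‖u‖_{H¹⁰} ‖v‖_{H¹⁰} ‖w‖_{H⁻⁹} · ‖m₁‖₀ ‖m₂‖₀ ‖m₃‖₀`. -/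
theorem enorm_eulerForm_slot_le_weighted (𝒜 : AveragingDatum) {C : ℝ}
    (hC : ∀ i θ, C⁻¹ ≤ 𝒜.lam i θ ∧ 𝒜.lam i θ ≤ C) (u v w : L2C) (θ : 𝒜.Ω) :
    ‖eulerForm (𝒜.slot 0 θ u) (𝒜.slot 1 θ v) (𝒜.slot 2 θ w)‖ₑ ≤
      (ENNReal.ofReal Real.pi * (2 ^ 9 * (2 * (∫⁻ ξ : EuclideanSpace ℝ (Fin 3),
          ENNReal.ofReal ((1 + ‖ξ‖ ^ 2) ^ (-10 : ℝ))) ^ (1 / 2 : ℝ))) *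
        ENNReal.ofReal (max 1 C ^ (10 : ℝ)) * ENNReal.ofReal (max 1 C ^ (10 : ℝ)) *
          ENNReal.ofReal (max 1 C ^ (-(-9) : ℝ))) *
        eFourierSobolevNorm 10 u * eFourierSobolevNorm 10 v * eFourierSobolevNorm (-9) w *
        (symbolSeminorm 0 (𝒜.m 0 θ) * symbolSeminorm 0 (𝒜.m 1 θ) * symbolSeminorm 0 (𝒜.m 2 θ)) := by
  set 𝒟 := 𝒜.toComplex with h𝒟
  -- `C > 0` and `λ⁻¹ ≤ C`
  have hCpos : 0 < C := lt_of_lt_of_le (𝒜.lam_pos 0 θ) (hC 0 θ).2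
  have hK : ∀ i, ENNReal.ofReal (max 1 (𝒜.lam i θ) ^ (10 : ℝ)) ≤ ENNReal.ofReal (max 1 C ^ (10 : ℝ)) :=
    fun i => ENNReal.ofReal_le_ofReal
      (Real.rpow_le_rpow (by positivity) (max_le_max le_rfl (hC i θ).2) (by norm_num))
  have hK' : ENNReal.ofReal (max 1 (𝒜.lam 2 θ)⁻¹ ^ (-(-9) : ℝ)) ≤ ENNReal.ofReal (max 1 C ^ (-(-9) : ℝ)) := by
    refine ENNReal.ofReal_le_ofReal (Real.rpow_le_rpow (by positivity) (max_le_max le_rfl ?_) (by norm_num))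
    have h := (hC 2 θ).1
    rwa [inv_le_comm₀ hCpos (𝒜.lam_pos 2 θ)] at h
  have h0 : eFourierSobolevNorm 10 (𝒜.slot 0 θ u) ≤ symbolSeminorm 0 (𝒜.m 0 θ) *
      (ENNReal.ofReal (max 1 C ^ (10 : ℝ)) * eFourierSobolevNorm 10 u) := by
    refine (𝒟.eFourierSobolevNorm_slot_le 0 θ (by norm_num : (0 : ℝ) ≤ 10) u).trans ?_
    rw [mul_assoc]
    exact mul_le_mul' le_rfl (mul_le_mul' (hK 0) le_rfl)
  have h1 : eFourierSobolevNorm 10 (𝒜.slot 1 θ v) ≤ symbolSeminorm 0 (𝒜.m 1 θ) *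
      (ENNReal.ofReal (max 1 C ^ (10 : ℝ)) * eFourierSobolevNorm 10 v) := by
    refine (𝒟.eFourierSobolevNorm_slot_le 1 θ (by norm_num : (0 : ℝ) ≤ 10) v).trans ?_
    rw [mul_assoc]
    exact mul_le_mul' le_rfl (mul_le_mul' (hK 1) le_rfl)
  have h2 : eFourierSobolevNorm (-9) (𝒜.slot 2 θ w) ≤ symbolSeminorm 0 (𝒜.m 2 θ) *
      (ENNReal.ofReal (max 1 C ^ (-(-9) : ℝ)) * eFourierSobolevNorm (-9) w) := by
    refine (eFourierSobolevNorm_slot_le_of_nonpos 𝒟 2 θ (by norm_num : (-9 : ℝ) ≤ 0) w).trans ?_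
    rw [mul_assoc]
    exact mul_le_mul' le_rfl (mul_le_mul' hK' le_rfl)
  calc ‖eulerForm (𝒜.slot 0 θ u) (𝒜.slot 1 θ v) (𝒜.slot 2 θ w)‖ₑ
      ≤ ENNReal.ofReal Real.pi * (2 ^ 9 * (2 * (∫⁻ ξ : EuclideanSpace ℝ (Fin 3),
          ENNReal.ofReal ((1 + ‖ξ‖ ^ 2) ^ (-10 : ℝ))) ^ (1 / 2 : ℝ)) *
          eFourierSobolevNorm 10 (𝒜.slot 0 θ u) * eFourierSobolevNorm 10 (𝒜.slot 1 θ v) *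
          eFourierSobolevNorm (-9) (𝒜.slot 2 θ w)) := enorm_eulerForm_le_weighted _ _ _
    _ ≤ ENNReal.ofReal Real.pi * (2 ^ 9 * (2 * (∫⁻ ξ : EuclideanSpace ℝ (Fin 3),
          ENNReal.ofReal ((1 + ‖ξ‖ ^ 2) ^ (-10 : ℝ))) ^ (1 / 2 : ℝ)) *
          (symbolSeminorm 0 (𝒜.m 0 θ) * (ENNReal.ofReal (max 1 C ^ (10 : ℝ)) * eFourierSobolevNorm 10 u)) *
          (symbolSeminorm 0 (𝒜.m 1 θ) * (ENNReal.ofReal (max 1 C ^ (10 : ℝ)) * eFourierSobolevNorm 10 v)) *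
          (symbolSeminorm 0 (𝒜.m 2 θ) * (ENNReal.ofReal (max 1 C ^ (-(-9) : ℝ)) * eFourierSobolevNorm (-9) w))) := by
        gcongr
    _ = _ := by ring

/-- **The tame bound for the averaged form** (Tao 2016, (1.14): `B̃` obeys the same Sobolev bounds
as `B`): for every averaging datum `𝒜` there is `K < ∞` with
`|⟨B̃(u,v), w⟩| ≤ K ‖u‖_{H¹⁰} ‖v‖_{H¹⁰} ‖w‖_{H⁻⁹}` for all `u, v` of finite `H¹⁰` norm and all
`w ∈ L²(ℝ³; ℂ³)` (pointwise bound, then the moment bound `𝔼 ‖m₁‖₀‖m₂‖₀‖m₃‖₀ < ∞`). -/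
theorem exists_enorm_form_le (𝒜 : AveragingDatum) :
    ∃ K : ℝ≥0, ∀ u v w : L2C, eFourierSobolevNorm 10 u < ⊤ → eFourierSobolevNorm 10 v < ⊤ →
      ‖𝒜.form u v w‖ₑ ≤ (K : ℝ≥0∞) * eFourierSobolevNorm 10 u * eFourierSobolevNorm 10 v *
        eFourierSobolevNorm (-9) w := by
  obtain ⟨C, hC⟩ := 𝒜.lam_bdd
  set Kpt : ℝ≥0∞ := ENNReal.ofReal Real.pi * (2 ^ 9 * (2 * (∫⁻ ξ : EuclideanSpace ℝ (Fin 3),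
      ENNReal.ofReal ((1 + ‖ξ‖ ^ 2) ^ (-10 : ℝ))) ^ (1 / 2 : ℝ))) *
    ENNReal.ofReal (max 1 C ^ (10 : ℝ)) * ENNReal.ofReal (max 1 C ^ (10 : ℝ)) *
      ENNReal.ofReal (max 1 C ^ (-(-9) : ℝ)) with hKpt
  set S : ℝ≥0∞ := ∫⁻ θ, symbolSeminorm 0 (𝒜.m 0 θ) * symbolSeminorm 0 (𝒜.m 1 θ) *
    symbolSeminorm 0 (𝒜.m 2 θ) ∂𝒜.μ with hS
  have hKpt_top : Kpt < ∞ := by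
    refine ENNReal.mul_lt_top (ENNReal.mul_lt_top (ENNReal.mul_lt_top (ENNReal.mul_lt_top
      ENNReal.ofReal_lt_top (ENNReal.mul_lt_top (ENNReal.pow_lt_top ENNReal.ofNat_lt_top)
      (ENNReal.mul_lt_top ENNReal.ofNat_lt_top Cemb_lt_top))) ENNReal.ofReal_lt_top)
      ENNReal.ofReal_lt_top) ENNReal.ofReal_lt_top
  have hS_top : S < ∞ := 𝒜.moment 0 0 0
  have hKS : Kpt * S ≠ ∞ := (ENNReal.mul_lt_top hKpt_top hS_top).ne
  refine ⟨(Kpt * S).toNNReal, fun u v w hu hv => ?_⟩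
  rw [ENNReal.coe_toNNReal hKS]
  set X : ℝ≥0∞ := eFourierSobolevNorm 10 u * eFourierSobolevNorm 10 v * eFourierSobolevNorm (-9) w
    with hX
  have hX_top : X < ∞ := ENNReal.mul_lt_top (ENNReal.mul_lt_top hu hv)
    ((eFourierSobolevNorm_neg_nine_le_enorm w).trans_lt enorm_lt_top)
  have hKX : Kpt * X ≠ ∞ := (ENNReal.mul_lt_top hKpt_top hX_top).ne
  calc ‖𝒜.form u v w‖ₑ
      ≤ ∫⁻ θ, ‖eulerForm (𝒜.slot 0 θ u) (𝒜.slot 1 θ v) (𝒜.slot 2 θ w)‖ₑ ∂𝒜.μ :=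
        enorm_integral_le_lintegral_enorm _
    _ ≤ ∫⁻ θ, Kpt * X * (symbolSeminorm 0 (𝒜.m 0 θ) * symbolSeminorm 0 (𝒜.m 1 θ) *
          symbolSeminorm 0 (𝒜.m 2 θ)) ∂𝒜.μ := by
        refine lintegral_mono fun θ => ?_
        refine (enorm_eulerForm_slot_le_weighted 𝒜 hC u v w θ).trans_eq ?_
        rw [hKpt, hX]
        ring
    _ = Kpt * X * S := lintegral_const_mul' _ _ hKX
    _ = Kpt * S * eFourierSobolevNorm 10 u * eFourierSobolevNorm 10 v * eFourierSobolevNorm (-9) w := by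
        rw [hX]
        ring

/-! ### Realness of the averaged form on real fields -/

/-- **Slots of real fields are Fourier-Hermitian** (real symbols `m_{i,θ}`, `Rot`, `Dil` preserve
realness; Tao 2016, p. 6). -/
theorem isFourierHermitian_slot (𝒜 : AveragingDatum) (i : Fin 3) (θ : 𝒜.Ω) {x : L2C} (hx : IsReal x) :
    IsFourierHermitian (𝒜.slot i θ x) :=
  IsFourierHermitian.fourierMultiplier (𝒜.isRealSymbol i θ).conj_toLp_ae
    (isReal_rot (isReal_dil hx _) _).isFourierHermitian

/-- **The averaged form is real on real fields**: `Im ⟨B̃(u,v), w⟩ = 0` for real `u, v, w ∈ L²`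
(each integrand `⟨B(A₁u, A₂v), A₃w⟩` is real: the `Aᵢ` of (1.12) have real symbols; Tao 2016,
p. 6 and §3.1 p. 15). No regularity or convergence is needed. -/
theorem form_im_eq_zero (𝒜 : AveragingDatum) {u v w : L2C} (hu : IsReal u) (hv : IsReal v)
    (hw : IsReal w) : (𝒜.form u v w).im = 0 :=
  ComplexAveragingDatum.integral_im_eq_zero_of_forall_im_eq_zero fun θ =>
    eulerForm_im_of_isFourierHermitian (isFourierHermitian_slot 𝒜 0 θ hu)
      (isFourierHermitian_slot 𝒜 1 θ hv) (isFourierHermitian_slot 𝒜 2 θ hw)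

/-! ### Trilinearity of the averaged form -/

/-- Slots are additive. -/
theorem slot_add (𝒜 : AveragingDatum) (i : Fin 3) (θ : 𝒜.Ω) (x y : L2C) :
    𝒜.slot i θ (x + y) = 𝒜.slot i θ x + 𝒜.slot i θ y := by
  simp only [AveragingDatum.slot, dil_add, rot_add, fourierMultiplier_add]

/-- Slots commute with complex scalars. -/
theorem slot_smul (𝒜 : AveragingDatum) (i : Fin 3) (θ : 𝒜.Ω) (c : ℂ) (x : L2C) :
    𝒜.slot i θ (c • x) = c • 𝒜.slot i θ x := by
  simp only [AveragingDatum.slot, dil_smul, rot_smul, fourierMultiplier_smul]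

/-- **`⟨B̃(u,v), w⟩` is additive in `u`** on fields of finite `H¹⁰` norm (`w ∈ L²` arbitrary):
slots are linear, the Euler form is additive on `H¹⁰` (absolute convergence of (1.3)) and the
`Ω`-integrands are integrable (absolute convergence of (1.13), Tao p. 7). -/
theorem form_add₁ (𝒜 : AveragingDatum) {u u' v : L2C} (w : L2C)
    (hu : eFourierSobolevNorm 10 u < ∞) (hu' : eFourierSobolevNorm 10 u' < ∞)
    (hv : eFourierSobolevNorm 10 v < ∞) :
    𝒜.form (u + u') v w = 𝒜.form u v w + 𝒜.form u' v w := by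
  have hint : Integrable (fun θ => eulerForm (𝒜.slot 0 θ u) (𝒜.slot 1 θ v) (𝒜.slot 2 θ w)) 𝒜.μ :=
    𝒜.toComplex.integrable_eulerForm_slot w hu hv
  have hint' : Integrable (fun θ => eulerForm (𝒜.slot 0 θ u') (𝒜.slot 1 θ v) (𝒜.slot 2 θ w)) 𝒜.μ :=
    𝒜.toComplex.integrable_eulerForm_slot w hu' hv
  unfold AveragingDatum.form
  rw [← integral_add hint hint']
  refine integral_congr_ae (Eventually.of_forall fun θ => ?_)
  have h0 : eFourierSobolevNorm 10 (𝒜.slot 0 θ u) < ∞ := 𝒜.toComplex.eFourierSobolevNorm_slot_lt_top 0 θ hu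
  have h0' : eFourierSobolevNorm 10 (𝒜.slot 0 θ u') < ∞ :=
    𝒜.toComplex.eFourierSobolevNorm_slot_lt_top 0 θ hu'
  have h1 : eFourierSobolevNorm 10 (𝒜.slot 1 θ v) < ∞ := 𝒜.toComplex.eFourierSobolevNorm_slot_lt_top 1 θ hv
  have key := eulerForm_add_smul₁ 1 (𝒜.slot 2 θ w) h0 h0' h1
  rw [one_smul, one_mul] at key
  change eulerForm (𝒜.slot 0 θ (u + u')) (𝒜.slot 1 θ v) (𝒜.slot 2 θ w) =
    eulerForm (𝒜.slot 0 θ u) (𝒜.slot 1 θ v) (𝒜.slot 2 θ w) +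
      eulerForm (𝒜.slot 0 θ u') (𝒜.slot 1 θ v) (𝒜.slot 2 θ w)
  rw [slot_add]
  exact key

/-- **`⟨B̃(u,v), w⟩` is homogeneous in `u`** (no convergence needed). -/
theorem form_smul₁ (𝒜 : AveragingDatum) (c : ℂ) (u v w : L2C) :
    𝒜.form (c • u) v w = c * 𝒜.form u v w := by
  unfold AveragingDatum.form
  rw [← integral_const_mul]
  refine integral_congr_ae (Eventually.of_forall fun θ => ?_)
  change eulerForm (𝒜.slot 0 θ (c • u)) (𝒜.slot 1 θ v) (𝒜.slot 2 θ w) =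
    c * eulerForm (𝒜.slot 0 θ u) (𝒜.slot 1 θ v) (𝒜.slot 2 θ w)
  rw [slot_smul, eulerForm_smul₁]

/-- **`⟨B̃(u,v), w⟩` is additive in `v`** on fields of finite `H¹⁰` norm. -/
theorem form_add₂ (𝒜 : AveragingDatum) {u v v' : L2C} (w : L2C)
    (hu : eFourierSobolevNorm 10 u < ∞) (hv : eFourierSobolevNorm 10 v < ∞)
    (hv' : eFourierSobolevNorm 10 v' < ∞) :
    𝒜.form u (v + v') w = 𝒜.form u v w + 𝒜.form u v' w := by
  have hint : Integrable (fun θ => eulerForm (𝒜.slot 0 θ u) (𝒜.slot 1 θ v) (𝒜.slot 2 θ w)) 𝒜.μ :=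
    𝒜.toComplex.integrable_eulerForm_slot w hu hv
  have hint' : Integrable (fun θ => eulerForm (𝒜.slot 0 θ u) (𝒜.slot 1 θ v') (𝒜.slot 2 θ w)) 𝒜.μ :=
    𝒜.toComplex.integrable_eulerForm_slot w hu hv'
  unfold AveragingDatum.form
  rw [← integral_add hint hint']
  refine integral_congr_ae (Eventually.of_forall fun θ => ?_)
  have h0 : eFourierSobolevNorm 10 (𝒜.slot 0 θ u) < ∞ := 𝒜.toComplex.eFourierSobolevNorm_slot_lt_top 0 θ hu
  have h1 : eFourierSobolevNorm 10 (𝒜.slot 1 θ v) < ∞ := 𝒜.toComplex.eFourierSobolevNorm_slot_lt_top 1 θ hv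
  have h1' : eFourierSobolevNorm 10 (𝒜.slot 1 θ v') < ∞ :=
    𝒜.toComplex.eFourierSobolevNorm_slot_lt_top 1 θ hv'
  have key := eulerForm_add_smul₂ 1 (𝒜.slot 2 θ w) h0 h1 h1'
  rw [one_smul, one_mul] at key
  change eulerForm (𝒜.slot 0 θ u) (𝒜.slot 1 θ (v + v')) (𝒜.slot 2 θ w) =
    eulerForm (𝒜.slot 0 θ u) (𝒜.slot 1 θ v) (𝒜.slot 2 θ w) +
      eulerForm (𝒜.slot 0 θ u) (𝒜.slot 1 θ v') (𝒜.slot 2 θ w)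
  rw [slot_add]
  exact key

/-- **`⟨B̃(u,v), w⟩` is homogeneous in `v`** (symmetry of `B` and homogeneity in the first slot). -/
theorem form_smul₂ (𝒜 : AveragingDatum) (c : ℂ) (u v w : L2C) :
    𝒜.form u (c • v) w = c * 𝒜.form u v w := by
  unfold AveragingDatum.form
  rw [← integral_const_mul]
  refine integral_congr_ae (Eventually.of_forall fun θ => ?_)
  change eulerForm (𝒜.slot 0 θ u) (𝒜.slot 1 θ (c • v)) (𝒜.slot 2 θ w) =
    c * eulerForm (𝒜.slot 0 θ u) (𝒜.slot 1 θ v) (𝒜.slot 2 θ w)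
  rw [slot_smul, eulerForm_symm, eulerForm_smul₁, eulerForm_symm]

/-- **`⟨B̃(u,v), w⟩` is additive in `w ∈ L²`** for `u, v` of finite `H¹⁰` norm (tree:
`average_eulerForm_add_smul`, the absolute convergence of (1.13)). -/
theorem form_add₃ (𝒜 : AveragingDatum) {u v : L2C} (w w' : L2C)
    (hu : eFourierSobolevNorm 10 u < ∞) (hv : eFourierSobolevNorm 10 v < ∞) :
    𝒜.form u v (w + w') = 𝒜.form u v w + 𝒜.form u v w' := by
  have h := 𝒜.toComplex.average_eulerForm_add_smul w w' 1 1 hu hv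
  rw [one_smul, one_smul, one_mul, one_mul] at h
  exact h

/-- **`⟨B̃(u,v), w⟩` is `ℂ`-homogeneous in `w ∈ L²`** for `u, v` of finite `H¹⁰` norm. -/
theorem form_smul₃ (𝒜 : AveragingDatum) {u v : L2C} (c : ℂ) (w : L2C)
    (hu : eFourierSobolevNorm 10 u < ∞) (hv : eFourierSobolevNorm 10 v < ∞) :
    𝒜.form u v (c • w) = c * 𝒜.form u v w := by
  have h := 𝒜.toComplex.average_eulerForm_add_smul w 0 c 0 hu hv
  rw [zero_smul, add_zero, zero_mul, add_zero] at h
  exact h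

end Summit.NavierStokesRegularity.NavierStokesRegularity.Theorems.PerpetualPumpThesis.B

namespace Summit.NavierStokesRegularity.NavierStokesRegularity.Theorems.PerpetualPumpThesis

open Literature.Analysis.FluidPDE Literature.Analysis.FluidPDE.Tao2016
open Literature.Analysis.FunctionSpaces (eFourierSobolevNorm)

/-- **Part F of stub B (registered sub-goal `stub_bilinearOperator_F`)**: the tame
`H¹⁰ × H¹⁰ × H⁻⁹` bound for Tao's averaged form — for every averaging datum `𝒜` there is a finite
`K` with `|⟨B̃(u,v), w⟩| ≤ K ‖u‖_{H¹⁰} ‖v‖_{H¹⁰} ‖w‖_{H⁻⁹}` for all `u, v` of finite `H¹⁰` norm and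
all `w ∈ L²(ℝ³; ℂ³)` (Tao 2016, (1.14)). -/
theorem stub_bilinearOperator_F : ∀ 𝒜 : AveragingDatum, ∃ K : NNReal, ∀ u v w : L2C, eFourierSobolevNorm 10 u < ⊤ → eFourierSobolevNorm 10 v < ⊤ → ‖𝒜.form u v w‖ₑ ≤ (K : ENNReal) * eFourierSobolevNorm 10 u * eFourierSobolevNorm 10 v * eFourierSobolevNorm (-9) w :=
  fun 𝒜 => B.exists_enorm_form_le 𝒜

end Summit.NavierStokesRegularity.NavierStokesRegularity.Theorems.PerpetualPumpThesis
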